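import Summits.Ventures.Crystal3D.Bulk.HullRotSysCycles
import Summits.Ventures.Crystal3D.Bulk.RotSysCounts
import HarnessLib

/-!
# The hull rotation system, part 4: as a loopless rotation system in the sense of
# `Bulk/RotSysCounts.lean`, with Euler count `χ₂ = 4 = 4·k` (brick (G2) of
# `phase2/LEAN-FACES-DESIGN.md` §5.3 — the ambient hypothesis of the deletion lemma (G1))

HONEST FRAMING. Part of the venture `Summits/Ventures/Crystal3D` (cell `pub-crystal3d`, phase 2;
seat p3), generic and configuration-free (`X` any finite set of unit vectors of `ℝ³` with
`0 ∈ interior (conv X)`); nothing here mentions GAP(1.26). This file packages the hull rotation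
system of `Bulk/HullRotSys{,Faces,Cycles}.lean` in typer-bulk-2's generic vocabulary
(`RotSys.IsRotSys`, `numV`, `numF`, `numK`, `chi2` of `Bulk/RotSysCounts.lean`):

* the dart TYPE `↥(hullDarts X)` (a `Fintype`), the rotation `rot hX1 h0 : Perm ↥(hullDarts X)`
  (`σ_H`, from `hullSucc_bijOn`) and the edge involution `inv X` (`α = Prod.swap`);
  **`isRotSys`**: `(rot, inv)` is a loopless rotation system;
* `sameCycle_rot_iff` (same vertex cycle ⇔ same tail), `phi_univ_apply` (the face permutation on
  the full dart set is `φ_H`), `sameCycle_phi_iff` (same face ⇔ same `faceTri`);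
* the counts on the full dart set `univ`: **`numV_univ = #X`**, **`numF_univ = #fanTriSets X`**,
  **`numK_univ = 1`**, `card_univ_darts` (`= 6·#X − 12`), and the Euler relation
  **`chi2_univ : chi2 rot inv univ = 4`** / **`chi2_univ_eq_numK : chi2 = 4·numK`** — i.e.
  `V − E + F = 2` for the hull map (`N − (3N−6) + (2N−4) = 2`).

So the (G1) programme's conclusion «`chi2 S = 4·numK S` for every `α`-closed `S` once it holds for
the ambient dart set» applies to this ambient system; wiring the oriented tight map of a GAP
configuration as the induced sub-system (G3) is NOT here.
-/

noncomputable section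

namespace Summit.Ventures.Crystal3D

namespace HullRotSys

open Literature.Geometry.DiscreteGeometry Finset Equiv

variable {X : Finset (EuclideanSpace ℝ (Fin 3))}

/-! ## A counting lemma: classes of a relation with a complete invariant -/

section Classes

open scoped Classical

/-- If `f` is a complete invariant for the relation `R` on `S` (`R x y ↔ f x = f y`), the number
of `R`-classes of `S` is the number of values of `f` on `S`. -/
theorem numClasses_eq_card_image {D β : Type*} [DecidableEq D] [DecidableEq β] {R : D → D → Prop}
    {S : Finset D} (f : D → β) (h : ∀ x ∈ S, ∀ y ∈ S, R x y ↔ f x = f y) :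
    RotSys.numClasses R S = (S.image f).card := by
  unfold RotSys.numClasses
  -- the class of `x` determines `f x` and conversely
  have key : ∀ x ∈ S, ∀ x' ∈ S,
      ((S.filter fun y => R x y) = S.filter fun y => R x' y) ↔ f x = f x' := by
    intro x hx x' hx'
    constructor
    · intro hc
      have hxm : x ∈ S.filter fun y => R x' y := by
        rw [← hc]; exact mem_filter.2 ⟨hx, (h x hx x hx).2 rfl⟩
      exact ((h x' hx' x hx).1 (mem_filter.1 hxm).2).symm
    · intro hf
      ext y
      simp only [mem_filter, and_congr_right_iff]
      intro hy
      rw [h x hx y hy, h x' hx' y hy, hf]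
  refine card_bij (fun c hc => f (Classical.choose (mem_image.1 hc)))
    (fun c hc => mem_image_of_mem f (Classical.choose_spec (mem_image.1 hc)).1)
    (fun c₁ hc₁ c₂ hc₂ heq => ?_) (fun b hb => ?_)
  · obtain ⟨hx₁, hc₁'⟩ := Classical.choose_spec (mem_image.1 hc₁)
    obtain ⟨hx₂, hc₂'⟩ := Classical.choose_spec (mem_image.1 hc₂)
    rw [← hc₁', ← hc₂']
    exact (key _ hx₁ _ hx₂).2 heq
  · obtain ⟨x, hx, rfl⟩ := mem_image.1 hb
    have hc : (S.filter fun y => R x y) ∈ S.image fun x => S.filter fun y => R x y :=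
      mem_image_of_mem _ hx
    refine ⟨_, hc, ?_⟩
    obtain ⟨hx', hc'⟩ := Classical.choose_spec (mem_image.1 hc)
    exact (key _ hx' _ hx).1 hc'

end Classes

/-! ## The rotation and the involution as permutations of the dart type -/

/-- **`σ_H` as a permutation of the dart type** `↥(hullDarts X)`. -/
def rot (hX1 : ∀ y ∈ X, ‖y‖ = 1) (h0 : (0 : EuclideanSpace ℝ (Fin 3)) ∈ interior (convexHull ℝ (X
    : Set _))) :
    Perm ↥(hullDarts X) :=
  Equiv.ofBijective (fun d => ⟨hullSucc X d.1, hullSucc_mem_hullDarts hX1 h0 d.2⟩)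
    ⟨fun d d' h => Subtype.ext (hullSucc_injOn hX1 h0 (Finset.mem_coe.2 d.2)
        (Finset.mem_coe.2 d'.2) (congrArg Subtype.val h)),
     fun d' => by
      obtain ⟨p, hp, hpe⟩ := (hullSucc_bijOn hX1 h0).surjOn (Finset.mem_coe.2 d'.2)
      exact ⟨⟨p, Finset.mem_coe.1 hp⟩, Subtype.ext hpe⟩⟩

/-- **`α` as a permutation of the dart type**: reversal. -/
def inv (X : Finset (EuclideanSpace ℝ (Fin 3))) : Perm ↥(hullDarts X) where
  toFun d := ⟨d.1.swap, swap_mem_hullDarts d.2⟩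
  invFun d := ⟨d.1.swap, swap_mem_hullDarts d.2⟩
  left_inv d := Subtype.ext (Prod.swap_swap d.1)
  right_inv d := Subtype.ext (Prod.swap_swap d.1)

variable {hX1 : ∀ y ∈ X, ‖y‖ = 1} {h0 : (0 : EuclideanSpace ℝ (Fin 3)) ∈ interior (convexHull ℝ (X
    : Set _))}

/-- Unfolding `rot`. -/
@[simp] theorem rot_apply_val (d : ↥(hullDarts X)) : (rot hX1 h0 d).1 = hullSucc X d.1 := rfl

/-- Unfolding `inv`. -/
@[simp] theorem inv_apply_val (d : ↥(hullDarts X)) : (inv X d).1 = d.1.swap := rfl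

/-- Powers of `rot` are iterates of `hullSucc`. -/
theorem rot_pow_apply_val (n : ℕ) (d : ↥(hullDarts X)) :
    ((rot hX1 h0 ^ n) d).1 = (hullSucc X)^[n] d.1 := by
  induction n with
  | zero => rfl
  | succ n ih => rw [pow_succ', Perm.mul_apply, rot_apply_val, ih, Function.iterate_succ_apply']

/-- Powers of `rot` fix the tail. -/
theorem rot_pow_apply_fst (n : ℕ) (d : ↥(hullDarts X)) : ((rot hX1 h0 ^ n) d).1.1 = d.1.1 := by
  rw [rot_pow_apply_val, iterate_hullSucc_fst]

/-- **Same vertex cycle ⇔ same tail.** -/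
theorem sameCycle_rot_iff (d d' : ↥(hullDarts X)) :
    (rot hX1 h0).SameCycle d d' ↔ d.1.1 = d'.1.1 := by
  constructor
  · intro h
    obtain ⟨i, -, hi⟩ := h.exists_pow_eq'
    rw [← hi, rot_pow_apply_fst]
  · intro h
    obtain ⟨k, hk⟩ := (exists_iterate_hullSucc_eq_iff hX1 h0 d.2 d'.2).2 h
    refine ⟨(k : ℤ), ?_⟩
    rw [zpow_natCast]
    exact Subtype.ext (by rw [rot_pow_apply_val, hk])

/-- **`(rot, inv)` is a loopless rotation system.** -/
theorem isRotSys : RotSys.IsRotSys (rot hX1 h0) (inv X) where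
  α_inv d := Subtype.ext (Prod.swap_swap d.1)
  α_ne d h := swap_ne_of_mem_hullDarts d.2 (congrArg Subtype.val h)
  loopless d h := by
    rw [sameCycle_rot_iff] at h
    exact fst_ne_snd_of_mem_hullDarts d.2 (by simpa using h)

/-! ## Vertices, faces, components on the full dart set -/

/-- The dart type has `#hullDarts X` elements. -/
theorem card_univ_darts : (univ : Finset ↥(hullDarts X)).card = (hullDarts X).card := by
  rw [Finset.card_univ, Fintype.card_coe]

/-- **`V = N`**: the vertex cycles of the full hull rotation system are in bijection with `X`. -/
theorem numV_univ : RotSys.numV (rot hX1 h0) (univ : Finset ↥(hullDarts X)) = X.card := by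
  classical
  unfold RotSys.numV
  rw [numClasses_eq_card_image (fun d : ↥(hullDarts X) => d.1.1)
    (fun d _ d' _ => sameCycle_rot_iff d d')]
  have himg : (univ : Finset ↥(hullDarts X)).image (fun d => d.1.1) =
      (hullDarts X).image Prod.fst := by
    ext y
    simp only [mem_image, mem_univ, true_and]
    constructor
    · rintro ⟨d, rfl⟩; exact ⟨d.1, d.2, rfl⟩
    · rintro ⟨p, hp, rfl⟩; exact ⟨⟨p, hp⟩, rfl⟩
  rw [himg, image_fst_hullDarts hX1 h0]

/-- On the full dart set the induced rotation is the rotation itself. -/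
theorem induce_univ_apply (d : ↥(hullDarts X)) :
    RotSys.induce (rot hX1 h0) univ d = rot hX1 h0 d :=
  RotSys.induce_eq_of_first_return _ (mem_univ d) Nat.one_pos (by rw [pow_one]) (mem_univ _)
    (fun m hm0 hm1 => absurd hm1 (by omega))

/-- **The face permutation on the full dart set is `φ_H`.** -/
theorem phi_univ_apply (d : ↥(hullDarts X)) :
    (RotSys.phi (rot hX1 h0) (inv X) univ d).1 = hullFace X d.1 := by
  rw [RotSys.phi_apply, induce_univ_apply]
  rfl

/-- Powers of the face permutation are iterates of `hullFace`. -/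
theorem phi_univ_pow_apply (n : ℕ) (d : ↥(hullDarts X)) :
    ((RotSys.phi (rot hX1 h0) (inv X) univ ^ n) d).1 = (hullFace X)^[n] d.1 := by
  induction n with
  | zero => rfl
  | succ n ih => rw [pow_succ', Perm.mul_apply, phi_univ_apply, ih, Function.iterate_succ_apply']

/-- `faceTri` is constant along iterates of `hullFace`. -/
theorem faceTri_iterate_hullFace (hX1 : ∀ y ∈ X, ‖y‖ = 1)
    (h0 : (0 : EuclideanSpace ℝ (Fin 3)) ∈ interior (convexHull ℝ (X : Set _))) {p
        : EuclideanSpace ℝ (Fin 3) × EuclideanSpace ℝ (Fin 3)} (hp : p ∈ hullDarts X)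
    (n : ℕ) : faceTri X ((hullFace X)^[n] p) = faceTri X p := by
  induction n with
  | zero => rfl
  | succ n ih =>
    have hmem : (hullFace X)^[n] p ∈ hullDarts X := by
      clear ih
      induction n with
      | zero => exact hp
      | succ m ihm => rw [Function.iterate_succ_apply']; exact hullFace_mem_hullDarts hX1 h0 ihm
    rw [Function.iterate_succ_apply', faceTri_hullFace hX1 h0 hmem, ih]

/-- **Same face cycle ⇔ same face triangle.** -/
theorem sameCycle_phi_iff (d d' : ↥(hullDarts X)) :
    (RotSys.phi (rot hX1 h0) (inv X) univ).SameCycle d d' ↔ faceTri X d.1 = faceTri X d'.1 := by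
  constructor
  · intro h
    obtain ⟨i, -, hi⟩ := h.exists_pow_eq'
    have := congrArg Subtype.val hi
    rw [phi_univ_pow_apply] at this
    rw [← this, faceTri_iterate_hullFace hX1 h0 d.2]
  · intro h
    rcases eq_or_eq_or_eq_of_faceTri_eq hX1 h0 d.2 d'.2 h.symm with h1 | h2 | h3
    · rw [Subtype.ext h1]
    · refine ⟨(1 : ℕ), ?_⟩
      rw [zpow_natCast, pow_one]
      exact Subtype.ext (by rw [phi_univ_apply]; exact h2.symm)
    · refine ⟨(2 : ℕ), ?_⟩
      rw [zpow_natCast]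
      exact Subtype.ext (by rw [phi_univ_pow_apply]; exact h3.symm)

/-- **`F = #fanTriSets X`**: the faces of the full hull rotation system are the fan triangles. -/
theorem numF_univ :
    RotSys.numF (rot hX1 h0) (inv X) (univ : Finset ↥(hullDarts X)) = (fanTriSets X).card := by
  classical
  unfold RotSys.numF
  rw [numClasses_eq_card_image (fun d : ↥(hullDarts X) => faceTri X d.1)
    (fun d _ d' _ => sameCycle_phi_iff d d')]
  congr 1
  ext t
  rw [mem_image]
  constructor
  · rintro ⟨d, -, rfl⟩
    exact faceTri_mem_fanTriSets hX1 h0 d.2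
  · intro ht
    obtain ⟨p, hp, rfl⟩ := exists_faceTri_eq hX1 h0 ht
    exact ⟨⟨p, hp⟩, mem_univ _, rfl⟩

/-- Every dart is connected to every other dart in the full hull rotation system. -/
theorem conn_univ (d₀ d : ↥(hullDarts X)) : RotSys.conn (rot hX1 h0) (inv X) univ d₀ d := by
  classical
  -- the component of `d₀`, pushed down to pairs of points, is closed under `σ_H` and `α`
  set S : Finset (EuclideanSpace ℝ (Fin 3) × EuclideanSpace ℝ (Fin 3)) :=
    (univ.filter fun d : ↥(hullDarts X) => RotSys.conn (rot hX1 h0) (inv X) univ d₀ d).image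
      Subtype.val with hS
  have hmemS : ∀ {d : ↥(hullDarts X)}, d.1 ∈ S ↔ RotSys.conn (rot hX1 h0) (inv X) univ d₀ d := by
    intro d
    rw [hS, mem_image]
    constructor
    · rintro ⟨d', hd', hdd'⟩
      rw [Subtype.ext hdd'] at hd'
      exact (mem_filter.1 hd').2
    · intro h
      exact ⟨d, mem_filter.2 ⟨mem_univ _, h⟩, rfl⟩
  have hSsub : S ⊆ hullDarts X := by
    intro p hp
    obtain ⟨d, -, rfl⟩ := mem_image.1 hp
    exact d.2
  have hne : S.Nonempty := ⟨d₀.1, hmemS.2 (RotSys.conn_refl _ _ _ d₀)⟩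
  have hsucc : ∀ p ∈ S, hullSucc X p ∈ S := by
    intro p hp
    obtain ⟨d, hd, rfl⟩ := mem_image.1 hp
    have hc := (mem_filter.1 hd).2
    have hstep : RotSys.conn (rot hX1 h0) (inv X) univ d (rot hX1 h0 d) :=
      Relation.EqvGen.rel _ _ ⟨mem_univ _, mem_univ _, Or.inl ⟨1, by rw [zpow_one]⟩⟩
    exact (hmemS (d := rot hX1 h0 d)).2 (RotSys.conn_trans hc hstep)
  have hswap : ∀ p ∈ S, p.swap ∈ S := by
    intro p hp
    obtain ⟨d, hd, rfl⟩ := mem_image.1 hp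
    have hc := (mem_filter.1 hd).2
    have hstep : RotSys.conn (rot hX1 h0) (inv X) univ d (inv X d) :=
      Relation.EqvGen.rel _ _ ⟨mem_univ _, mem_univ _, Or.inr rfl⟩
    exact (hmemS (d := inv X d)).2 (RotSys.conn_trans hc hstep)
  have hall := eq_hullDarts_of_closed hX1 h0 hSsub hne hsucc hswap
  have hd : d.1 ∈ S := by rw [hall]; exact d.2
  exact hmemS.1 hd

/-- The dart set is nonempty (`X ≠ ∅` since `0 ∈ interior (conv X)`). -/
theorem hullDarts_nonempty (hX1 : ∀ y ∈ X, ‖y‖ = 1)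
    (h0 : (0 : EuclideanSpace ℝ (Fin 3)) ∈ interior (convexHull ℝ (X : Set _))) :
        (hullDarts X).Nonempty := by
  have hX : X.Nonempty := by
    by_contra h
    rw [not_nonempty_iff_eq_empty] at h
    rw [h, coe_empty, convexHull_empty, interior_empty] at h0
    exact h0
  obtain ⟨y, hy⟩ := hX
  obtain ⟨a, ha⟩ := exists_mk_mem_hullDarts hX1 h0 hy
  exact ⟨_, ha⟩

/-- **`k = 1`**: the full hull rotation system is connected. -/
theorem numK_univ : RotSys.numK (rot hX1 h0) (inv X) (univ : Finset ↥(hullDarts X)) = 1 := by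
  classical
  unfold RotSys.numK
  rw [numClasses_eq_card_image (fun _ : ↥(hullDarts X) => (0 : ℕ))
    (fun d _ d' _ => iff_of_true (conn_univ d d') rfl)]
  obtain ⟨p, hp⟩ := hullDarts_nonempty hX1 h0
  have hne : (univ : Finset ↥(hullDarts X)).Nonempty := ⟨⟨p, hp⟩, mem_univ _⟩
  rw [image_const hne, card_singleton]

/-- **Euler's relation for the hull map**: `χ₂ = 2V − #darts + 2F = 2N − (6N − 12) + 2(2N − 4) = 4`,
i.e. `V − E + F = 2`. -/
theorem chi2_univ : RotSys.chi2 (rot hX1 h0) (inv X) (univ : Finset ↥(hullDarts X)) = 4 := by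
  unfold RotSys.chi2
  rw [numV_univ, numF_univ, card_univ_darts]
  have h1 := card_hullDarts_add_twelve hX1 h0
  have h2 := card_fanTriSets_add_four hX1 h0
  omega

/-- **The ambient hypothesis of (G1)**: `chi2 = 4 · numK` on the full dart set of the hull
rotation system (both sides equal `4`). -/
theorem chi2_univ_eq_numK :
    RotSys.chi2 (rot hX1 h0) (inv X) (univ : Finset ↥(hullDarts X)) =
      4 * RotSys.numK (rot hX1 h0) (inv X) univ := by
  rw [chi2_univ, numK_univ]; norm_num

end HullRotSys

end Summit.Ventures.Crystal3D
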